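/-
Copyright (c) 2026 the pub-hodgecm-mathlib formalisation cell (harness21).  Prover seat hodgecm-mathlib-LH7-p01 (g8): N8-INNER ROAD B, E3 co-slice §2(7) «the per-ball test
function is in `C_c^∞(G′_∞)`», carved by the E3 holder LH3-p04 (g7) 2026-09-02T17:10:40Z under the road owner LH2-plan (g1).
-/
import Literature.NumberTheory.Rogawski1990.ArchSmoothTensor                      -- ★ (J) p852156 LH7-p04: `ArchSmooth.ambientMul`, `exists_real_archSmooth_eq_one_on` (plateau functions); brings ★ F4 `bzClassG`, `bzClassG_eq_trace_minorSum_det`, `snd_coe_coe_apply`, ★ `contDiff_apply_snd_apply`, ★ `ArchSmooth`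
import Literature.NumberTheory.Automorphic.UnitaryFormGroupTestFunctionExtension   -- ★ `isClosedEmbedding_coe_unitaryGroupOfForm` (`U(⋆, H)(ℂ) ↪ M_n(ℂ)` closed embedding, `det H ≠ 0`) — §5 only
import HarnessLib

/-!
# EP ASSEMBLY, §2(7) plumbing: the per-ball test function `k ↦ (Π_{w∈D} m_w(cl_w k) · f_w(k_w)) · G(cl_D k, k_I)` is in `C_c^∞(G′_∞)` (Borel–Jacquet 1979 §4.1; Bouaziz 1994 §2.3, §6.2)

Topic `NumberTheory/Rogawski1990`; namespace `Literature.NumberTheory.Rogawski1990`.  THEOREMS ONLY (no `def`, no instance, no notation, no axiom, no named fact, no `sorry`);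
kernel lane `--kind proof --supports stmt-HodgeConjecture-24833`.  Cell `pub/hodgecm-mathlib`, crux H413 (`stmt-HodgeConjecture-24833`); HCML «GO 500» road N8-INNER ROAD B «EP road»
(owner∕dealer LH2-plan (g1)), brick (12′) «EP ASSEMBLY = H-S4′», file E3a `ArchEPAssemblyLocal` (holder LH3-p04 (g7), CENSUS-E3 v1 `F0/P3c/LH3/LH3-p04/g7/e3/CENSUS-E3.v1.LH3p04g7.md`
4ea0a8286c8e31d7 §2(7)): this file is the CO-SLICE §2(7) — «`ArchSmooth L 3 (diagonal β₀) f_J`» — in the currencies already fixed by the road: ★ F4 `bzClassG L α k : W → ℂ × ℂ × ℂ`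
(place classes), ★ E3b's `↥D`-indexed class multipliers `m_d : ℂ × ℂ × ℂ → ℂ`, ★ E1∕E3b §4's one-place test functions `f_d : U(α)_d → ℂ` «ambient `C^∞` + compact support», and
★ (B3) p852202's parameter currency `P := (I → Matrix (Fin 3) (Fin 3) ℂ)` for the coupling factor `G : (↥D → ℂ × ℂ × ℂ) × P → ℂ` (the local Glaeser output `Ã_J`, possibly
pre-composed with the fixed place conjugations `ι_I⁻¹`).  Frame-generic: stated for any diagonal `α` (E3a reads it at `β₀ = ![(2:L)⁻¹, 1, -(2:L)⁻¹]`).  Count-neutral calculus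
plumbing; HONEST LABEL: HC_CM is proved only modulo the 7 printed citations (2 remaining: hLiu418 = stmt-HodgeConjecture-24832, h413 = stmt-HodgeConjecture-24833) until rung 0 closes.

WHAT IS PROVED.
* §1 **`archSmooth_of_eq_ambient`** — THE RESTRICTION PRINCIPLE behind every `ArchSmooth` construction of the road: a function on `G′_∞` which (i) is the restriction of an
  ambient `C^∞` function `Ψ` on `M₃(L ⊗ ℝ)` and (ii) has compact support, is `ArchSmooth L 3 (diag α)` (★ plateau function `= 1` on its support, ★ `ArchSmooth.ambientMul`).
* §2 the AMBIENT BUILDING BLOCKS, exported once: `contDiff_placeMatrix`∕`placeMatrix_coe_coe` (the place component `k_w` is the `C^∞` coordinate matrix `((k_{ij})_w)`, ★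
  `snd_coe_coe_apply`), `exists_contDiff_eq_bzClassG` (the class map `cl = bzClassG L α` is the restriction of a `C^∞` map on `M₃(L ⊗ ℝ)` — the entry polynomials
  `(tr, e₂, det)` of ★ `bzClassG_eq_trace_minorSum_det`, ★ F4's proof of `ArchSmooth.classMul` made a statement), `contDiff_couplingArg` (the argument
  `X ↦ (cl_D X, X_I)` of the coupling factor is `C^∞`).
* §3 **`ArchSmooth.mul_coupling`** — `a′ ∈ C_c^∞(G′_∞)`, `G` smooth on `(↥D → ℂ³) × (I → M₃(ℂ))` ⇒ `k ↦ a′ k · G(cl_D k, k_I)` is `ArchSmooth` (★ `ambientMul`).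
* §4 **`archSmooth_prod_classMul_tensor_mul_coupling`** — THE E3a HEAD §2(7): for `↥D`-indexed smooth class multipliers `m_d`, one-place test functions `f_d` (ambient `C^∞`,
  compact support) and a smooth coupling factor `G`, the per-ball test function `k ↦ (Π_{d} m_d(cl_d k) · f_d(k_d)) · G(cl_D k, (k_{v i})_i)` is `ArchSmooth L 3 (diag α)` as soon as
  the places off `D` are covered by the block `v : I → W` and `G` is SUPPORTED OVER A COMPACT IN THE `I`-VARIABLE in group currency: whenever the `D`-factor does not vanish at `k` and
  `G(cl_D k, k_I) ≠ 0`, the `I`-block `k_I` is the `I`-block of a point of a fixed compact `E₀ ⊆ G′_∞` (for E3a: `E₀ = tsupport a′`, by the definition of `Ā_{a′}` and the Glaeser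
  agreement on the multiplier balls).  Riders: the `HasCompactSupport` statement alone, and the `Finset`-indexed reading `∏ w ∈ D`.
* §5 **`archSmooth_prod_classMul_tensor_mul_coupling_of_ambient`** — the same with the support clause on the AMBIENT block: a compact `KI ⊆ (I → M₃(ℂ))` off which `G(cl_D k, k_I)`
  vanishes (needs `α_i ≠ 0`: the coercion `U(α)_w → M₃(ℂ)` is a closed embedding, ★ `isClosedEmbedding_coe_unitaryGroupOfForm`); cut-off readings `…_of_forall_eq_zero`
  (`G (y, z) = 0` off `KI`, the HANDOFF-E3 §4(6) `χ_I` form) and `…_of_hasCompactSupport` (`HasCompactSupport G`).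

## References
* [BorelJacquet1979] A. Borel, H. Jacquet, *Automorphic forms and automorphic representations*, Proc. Sympos. Pure Math. 33 (1979), part 1, §1.1, §4.1 (`C_c^∞(G_∞)`, tensors).
* [Bouaziz1994IntegralesOrbitales] A. Bouaziz, *Intégrales orbitales sur les groupes de Lie réductifs*, Ann. Sci. ÉNS (4) 27 (1994), §2.3 p. 578 (test functions), §6.2 pp. 591–594
  (partitions of unity in class space, invariant multipliers).
* [Rogawski1990] J. D. Rogawski, *Automorphic Representations of Unitary Groups in Three Variables*, Ann. of Math. Stud. 123 (1990), §14.2 p. 233 (`f′_∞ ∈ C_c^∞(G′_∞)`), §4.3 p. 43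
  (`G_∞ = Π_w G_w`).
-/

set_option autoImplicit false

noncomputable section

open NumberField NumberField.InfinitePlace NumberField.mixedEmbedding Matrix Complex Set Filter Topology Function
open scoped MatrixGroups Matrix Classical ContDiff
open Literature.NumberTheory.Automorphic Literature.NumberTheory.Automorphic.UnitaryGroup

namespace Literature.NumberTheory.Rogawski1990

-- the scoped `ℓ^∞`-operator norm on `M₃(L ⊗ ℝ)` and `M₃(ℂ)` (the one through which ★ `IsArchSmooth` and ★ E1's ambient `fa` are read)
open scoped Matrix.Norms.Operator

/-! ## §1 The restriction principle -/

section Restrict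

variable (L : Type) [Field L] [NumberField L] [IsCMField L] (α : Fin 3 → L)

/-- **THE RESTRICTION PRINCIPLE FOR `C_c^∞(G′_∞)`**: a function `f` on `G′_∞ = U(diag α)(L⁺ ⊗ ℝ)` which is the restriction of an ambient `C^∞` function `Ψ` on `M₃(L ⊗ ℝ)`
and has compact support is `ArchSmooth L 3 (diag α)`.  PROOF: `f = (Ψ ∘ val) · 𝟙` with `𝟙` the ★ plateau function (`exists_real_archSmooth_eq_one_on`) equal to `1` on the compact
`tsupport f`; ★ `ArchSmooth.ambientMul`. [cite: BorelJacquet1979, §4.1] [cite: Bouaziz1994IntegralesOrbitales, §2.3 p. 578] -/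
theorem archSmooth_of_eq_ambient {Ψ : Matrix (Fin 3) (Fin 3) (mixedSpace L) → ℂ} (hΨ : ContDiff ℝ ∞ Ψ)
    {f : ↥(arch (↥(maximalRealSubfield L)) L (IsCMField.complexConj L) 3 (Matrix.diagonal α)) → ℂ}
    (hf : ∀ k, f k = Ψ ((k : GL (Fin 3) (mixedSpace L)) : Matrix (Fin 3) (Fin 3) (mixedSpace L))) (hfs : HasCompactSupport f) :
    ArchSmooth L 3 (Matrix.diagonal α) f := by
  obtain ⟨pl, -, -, hpl1, hpla⟩ := exists_real_archSmooth_eq_one_on L α hfs.isCompact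
  have h := ArchSmooth.ambientMul L α hpla hΨ
  have heq : (fun k : ↥(arch (↥(maximalRealSubfield L)) L (IsCMField.complexConj L) 3 (Matrix.diagonal α)) =>
      Ψ ((k : GL (Fin 3) (mixedSpace L)) : Matrix (Fin 3) (Fin 3) (mixedSpace L)) * ((pl k : ℝ) : ℂ)) = f := by
    funext k
    by_cases hk : k ∈ tsupport f
    · rw [hpl1 k hk, Complex.ofReal_one, mul_one, hf]
    · rw [← hf, image_eq_zero_of_notMem_tsupport hk, zero_mul]
  rw [heq] at h
  exact h

/-- **Restriction principle, existential ambient form** (`∃ Ψ, C^∞ ∧ f = Ψ ∘ val`). [cite: BorelJacquet1979, §4.1] -/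
theorem archSmooth_of_exists_eq_ambient {f : ↥(arch (↥(maximalRealSubfield L)) L (IsCMField.complexConj L) 3 (Matrix.diagonal α)) → ℂ}
    (hf : ∃ Ψ : Matrix (Fin 3) (Fin 3) (mixedSpace L) → ℂ, ContDiff ℝ ∞ Ψ ∧ ∀ k, f k = Ψ ((k : GL (Fin 3) (mixedSpace L)) : Matrix (Fin 3) (Fin 3) (mixedSpace L)))
    (hfs : HasCompactSupport f) : ArchSmooth L 3 (Matrix.diagonal α) f := by
  obtain ⟨Ψ, hΨ, hfΨ⟩ := hf
  exact archSmooth_of_eq_ambient L α hΨ hfΨ hfs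

/-- Conversely an `ArchSmooth` function IS such a restriction with compact support (★ `ArchSmooth.exists_contDiff`, ★ `ArchSmooth.hasCompactSupport`) — so §1 characterises
`C_c^∞(G′_∞)`. [cite: BorelJacquet1979, §4.1] -/
theorem archSmooth_iff_exists_eq_ambient (f : ↥(arch (↥(maximalRealSubfield L)) L (IsCMField.complexConj L) 3 (Matrix.diagonal α)) → ℂ) :
    ArchSmooth L 3 (Matrix.diagonal α) f ↔
      (∃ Ψ : Matrix (Fin 3) (Fin 3) (mixedSpace L) → ℂ, ContDiff ℝ ∞ Ψ ∧ ∀ k, f k = Ψ ((k : GL (Fin 3) (mixedSpace L)) : Matrix (Fin 3) (Fin 3) (mixedSpace L))) ∧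
        HasCompactSupport f := by
  refine ⟨fun h => ⟨?_, h.hasCompactSupport⟩, fun h => archSmooth_of_exists_eq_ambient L α h.1 h.2⟩
  obtain ⟨Θ, hΘ, -, -, hΘf⟩ := h.exists_contDiff
  exact ⟨Θ, hΘ, hΘf⟩

end Restrict

/-! ## §2 Ambient building blocks: place coordinates, the class map, the coupling argument -/

section Ambient

variable (L : Type) [Field L] [NumberField L] [IsCMField L] (α : Fin 3 → L)

omit [IsCMField L] in
set_option backward.isDefEq.respectTransparency false in
/-- The place-`w` coordinate matrix `X ↦ ((X_{ij})_w)_{ij} : M₃(L ⊗ ℝ) → M₃(ℂ)` is `C^∞` (an `ℝ`-linear map on a finite-dimensional space). [cite: BorelJacquet1979, §4.1] -/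
theorem contDiff_placeMatrix (w : {w : InfinitePlace L // IsComplex w}) :
    ContDiff ℝ ∞ fun X : Matrix (Fin 3) (Fin 3) (mixedSpace L) => Matrix.of fun i j => (X i j).2 w := by
  haveI : FiniteDimensional ℝ (Matrix (Fin 3) (Fin 3) (mixedSpace L)) := finiteDimensional_matrix_mixedSpace
  exact (LinearMap.toContinuousLinearMap
    (⟨⟨fun X : Matrix (Fin 3) (Fin 3) (mixedSpace L) => Matrix.of fun i j => (X i j).2 w, fun _ _ => rfl⟩, fun _ _ => rfl⟩ :
      Matrix (Fin 3) (Fin 3) (mixedSpace L) →ₗ[ℝ] Matrix (Fin 3) (Fin 3) ℂ)).contDiff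

/-- On `G′_∞` the place-`w` coordinate matrix IS the place component `k_w = (archPiEquivCM k) w` (★ `snd_coe_coe_apply`, definitional). [cite: Rogawski1990, §4.3 p. 43] -/
theorem placeMatrix_coe_coe (k : ↥(arch (↥(maximalRealSubfield L)) L (IsCMField.complexConj L) 3 (Matrix.diagonal α))) (w : {w : InfinitePlace L // IsComplex w}) :
    (Matrix.of fun i j => ((((k : GL (Fin 3) (mixedSpace L)) : Matrix (Fin 3) (Fin 3) (mixedSpace L)) i j).2 w)) =
      ((archPiEquivCM 3 L (Matrix.diagonal α) k w : GL (Fin 3) ℂ) : Matrix (Fin 3) (Fin 3) ℂ) :=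
  Matrix.ext fun i j => by rw [Matrix.of_apply]; exact snd_coe_coe_apply L α k w i j

/-- **THE CLASS MAP IS THE RESTRICTION OF AN AMBIENT `C^∞` MAP**: there is `cl : M₃(L ⊗ ℝ) → (W → ℂ × ℂ × ℂ)` of class `C^∞` with `cl(k) = bzClassG L α k` on `G′_∞` — the entry
polynomials `(tr, e₂, det)` of the place coordinate matrices (★ `bzClassG_eq_trace_minorSum_det`; ★ F4's proof of `ArchSmooth.classMul`, exported as a statement).
[cite: Bouaziz1994IntegralesOrbitales, §2.3 p. 578] -/
theorem exists_contDiff_eq_bzClassG :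
    ∃ cl : Matrix (Fin 3) (Fin 3) (mixedSpace L) → ({w : InfinitePlace L // IsComplex w} → ℂ × ℂ × ℂ), ContDiff ℝ ∞ cl ∧
      ∀ k : ↥(arch (↥(maximalRealSubfield L)) L (IsCMField.complexConj L) 3 (Matrix.diagonal α)),
        cl ((k : GL (Fin 3) (mixedSpace L)) : Matrix (Fin 3) (Fin 3) (mixedSpace L)) = bzClassG L α k := by
  refine ⟨fun X w => ((X 0 0).2 w + (X 1 1).2 w + (X 2 2).2 w,
        (X 0 0).2 w * (X 1 1).2 w - (X 0 1).2 w * (X 1 0).2 w + ((X 0 0).2 w * (X 2 2).2 w - (X 0 2).2 w * (X 2 0).2 w) + ((X 1 1).2 w * (X 2 2).2 w - (X 1 2).2 w * (X 2 1).2 w),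
        Matrix.det (fun i j : Fin 3 => (X i j).2 w)), ?_, fun k => ?_⟩
  · refine contDiff_pi.2 fun w => (((contDiff_apply_snd_apply L 0 0 w).add (contDiff_apply_snd_apply L 1 1 w)).add (contDiff_apply_snd_apply L 2 2 w)).prodMk
      ((((((contDiff_apply_snd_apply L 0 0 w).mul (contDiff_apply_snd_apply L 1 1 w)).sub ((contDiff_apply_snd_apply L 0 1 w).mul (contDiff_apply_snd_apply L 1 0 w))).add
        (((contDiff_apply_snd_apply L 0 0 w).mul (contDiff_apply_snd_apply L 2 2 w)).sub ((contDiff_apply_snd_apply L 0 2 w).mul (contDiff_apply_snd_apply L 2 0 w)))).add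
        (((contDiff_apply_snd_apply L 1 1 w).mul (contDiff_apply_snd_apply L 2 2 w)).sub ((contDiff_apply_snd_apply L 1 2 w).mul (contDiff_apply_snd_apply L 2 1 w)))).prodMk ?_)
    -- the determinant of the `w`-coordinates: a polynomial in the nine `C^∞` coordinates
    have h : (fun X : Matrix (Fin 3) (Fin 3) (mixedSpace L) => Matrix.det (fun i j : Fin 3 => (X i j).2 w)) = fun X =>
        (X 0 0).2 w * (X 1 1).2 w * (X 2 2).2 w - (X 0 0).2 w * (X 1 2).2 w * (X 2 1).2 w - (X 0 1).2 w * (X 1 0).2 w * (X 2 2).2 w +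
          (X 0 1).2 w * (X 1 2).2 w * (X 2 0).2 w + (X 0 2).2 w * (X 1 0).2 w * (X 2 1).2 w - (X 0 2).2 w * (X 1 1).2 w * (X 2 0).2 w := by
      funext X; exact Matrix.det_fin_three _
    rw [h]
    exact ((((((contDiff_apply_snd_apply L 0 0 w).mul (contDiff_apply_snd_apply L 1 1 w)).mul (contDiff_apply_snd_apply L 2 2 w)).sub
      (((contDiff_apply_snd_apply L 0 0 w).mul (contDiff_apply_snd_apply L 1 2 w)).mul (contDiff_apply_snd_apply L 2 1 w))).sub
      (((contDiff_apply_snd_apply L 0 1 w).mul (contDiff_apply_snd_apply L 1 0 w)).mul (contDiff_apply_snd_apply L 2 2 w))).add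
      (((contDiff_apply_snd_apply L 0 1 w).mul (contDiff_apply_snd_apply L 1 2 w)).mul (contDiff_apply_snd_apply L 2 0 w))).add
      (((contDiff_apply_snd_apply L 0 2 w).mul (contDiff_apply_snd_apply L 1 0 w)).mul (contDiff_apply_snd_apply L 2 1 w)) |>.sub
      (((contDiff_apply_snd_apply L 0 2 w).mul (contDiff_apply_snd_apply L 1 1 w)).mul (contDiff_apply_snd_apply L 2 0 w))
  · funext w
    rw [bzClassG_eq_trace_minorSum_det L α k w rfl, Matrix.trace_fin_three]
    simp only [snd_coe_coe_apply]

omit [IsCMField L] in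
/-- The `I`-block of place coordinate matrices `X ↦ (((X_{ij})_{v i})_{ij})_{i ∈ I}` is `C^∞`. [cite: BorelJacquet1979, §4.1] -/
theorem contDiff_placeMatrix_block {I : Type*} [Fintype I] (v : I → {w : InfinitePlace L // IsComplex w}) :
    ContDiff ℝ ∞ fun X : Matrix (Fin 3) (Fin 3) (mixedSpace L) => fun i : I => Matrix.of fun a b => (X a b).2 (v i) :=
  contDiff_pi.2 fun i => contDiff_placeMatrix L (v i)

/-- **THE ARGUMENT OF THE COUPLING FACTOR IS THE RESTRICTION OF A `C^∞` MAP**: `X ↦ (cl_D X, X_I) : M₃(L ⊗ ℝ) → (↥D → ℂ × ℂ × ℂ) × (I → M₃(ℂ))` is `C^∞` for the ambient class map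
`cl` of `exists_contDiff_eq_bzClassG`, and on `G′_∞` it reads `(d ↦ bzClassG L α k d, i ↦ k_{v i})`. [cite: Bouaziz1994IntegralesOrbitales, §6.2 p. 591] [cite: BorelJacquet1979, §4.1] -/
theorem exists_contDiff_couplingArg (D : Finset {w : InfinitePlace L // IsComplex w}) {I : Type*} [Fintype I] (v : I → {w : InfinitePlace L // IsComplex w}) :
    ∃ arg : Matrix (Fin 3) (Fin 3) (mixedSpace L) → (↥D → ℂ × ℂ × ℂ) × (I → Matrix (Fin 3) (Fin 3) ℂ), ContDiff ℝ ∞ arg ∧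
      ∀ k : ↥(arch (↥(maximalRealSubfield L)) L (IsCMField.complexConj L) 3 (Matrix.diagonal α)),
        arg ((k : GL (Fin 3) (mixedSpace L)) : Matrix (Fin 3) (Fin 3) (mixedSpace L)) =
          (fun d : ↥D => bzClassG L α k d, fun i => ((archPiEquivCM 3 L (Matrix.diagonal α) k (v i) : GL (Fin 3) ℂ) : Matrix (Fin 3) (Fin 3) ℂ)) := by
  obtain ⟨cl, hcl, hclk⟩ := exists_contDiff_eq_bzClassG L α
  have hD : ContDiff ℝ ∞ fun X : Matrix (Fin 3) (Fin 3) (mixedSpace L) => fun d : ↥D => cl X d :=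
    contDiff_pi.2 fun d : ↥D => (contDiff_apply ℝ (ℂ × ℂ × ℂ) (d : {w : InfinitePlace L // IsComplex w})).comp hcl
  refine ⟨fun X => (fun d : ↥D => cl X d, fun i : I => Matrix.of fun a b => (X a b).2 (v i)), hD.prodMk (contDiff_placeMatrix_block L v), fun k => ?_⟩
  refine Prod.ext (funext fun d => ?_) (funext fun i => placeMatrix_coe_coe L α k (v i))
  show cl ((k : GL (Fin 3) (mixedSpace L)) : Matrix (Fin 3) (Fin 3) (mixedSpace L)) d = bzClassG L α k d
  rw [hclk k]

end Ambient

/-! ## §3 `C_c^∞(G′_∞)` times a smooth coupling factor -/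

section Coupling

variable (L : Type) [Field L] [NumberField L] [IsCMField L] (α : Fin 3 → L)

/-- **`a′ · G(cl_D ·, ·_I)` IS IN `C_c^∞(G′_∞)`**: for `a′ ∈ ArchSmooth L 3 (diag α)` and a coupling factor `G : (↥D → ℂ × ℂ × ℂ) × (I → M₃(ℂ)) → ℂ` of class `C^∞` (★ (B3)'s parameter currency
`P := I → M₃(ℂ)`), `k ↦ a′ k · G(d ↦ bzClassG L α k d, i ↦ k_{v i})` is `ArchSmooth L 3 (diag α)` (★ `ArchSmooth.ambientMul` with the ambient argument of §2).
[cite: BorelJacquet1979, §4.1] [cite: Bouaziz1994IntegralesOrbitales, §6.2 p. 591] -/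
theorem ArchSmooth.mul_coupling {a' : ↥(arch (↥(maximalRealSubfield L)) L (IsCMField.complexConj L) 3 (Matrix.diagonal α)) → ℂ} (ha' : ArchSmooth L 3 (Matrix.diagonal α) a')
    (D : Finset {w : InfinitePlace L // IsComplex w}) {I : Type*} [Fintype I] (v : I → {w : InfinitePlace L // IsComplex w})
    {G : (↥D → ℂ × ℂ × ℂ) × (I → Matrix (Fin 3) (Fin 3) ℂ) → ℂ} (hG : ContDiff ℝ ∞ G) :
    ArchSmooth L 3 (Matrix.diagonal α) fun k => a' k *
      G (fun d : ↥D => bzClassG L α k d, fun i => ((archPiEquivCM 3 L (Matrix.diagonal α) k (v i) : GL (Fin 3) ℂ) : Matrix (Fin 3) (Fin 3) ℂ)) := by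
  obtain ⟨arg, harg, hargk⟩ := exists_contDiff_couplingArg L α D v
  have h := ArchSmooth.ambientMul L α ha' (hG.comp harg)
  have heq : (fun k : ↥(arch (↥(maximalRealSubfield L)) L (IsCMField.complexConj L) 3 (Matrix.diagonal α)) =>
      (G ∘ arg) ((k : GL (Fin 3) (mixedSpace L)) : Matrix (Fin 3) (Fin 3) (mixedSpace L)) * a' k) =
      fun k => a' k * G (fun d : ↥D => bzClassG L α k d, fun i => ((archPiEquivCM 3 L (Matrix.diagonal α) k (v i) : GL (Fin 3) ℂ) : Matrix (Fin 3) (Fin 3) ℂ)) := by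
    funext k
    rw [Function.comp_apply, hargk k, mul_comm]
  rw [heq] at h
  exact h

end Coupling

/-! ## §4 The per-ball test function of the EP assembly -/

section PerBall

variable (L : Type) [Field L] [NumberField L] [IsCMField L] (α : Fin 3 → L)

/-- **THE PER-BALL TEST FUNCTION HAS COMPACT SUPPORT** under the group-currency support hypothesis: if the places off `D` are covered by the block `v : I → W` (`hcov`) and, whenever the
`D`-factor `Π_d m_d(cl_d k) · f_d(k_d)` has no vanishing factor at `k` and `G(cl_D k, k_I) ≠ 0`, the `I`-block of `k` is the `I`-block of a point of the compact `E₀ ⊆ G′_∞` (`hG0`), then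
`k ↦ (Π_d m_d(cl_d k) · f_d(k_d)) · G(cl_D k, k_I)` vanishes off the compact `e⁻¹(Π_w C_w)`, `C_d = tsupport f_d` on `D`, `C_w = (E₀)_w` off `D`. [cite: BorelJacquet1979, §4.1] [cite: Rogawski1990, §4.3 p. 43] -/
theorem hasCompactSupport_prod_classMul_tensor_mul_coupling (D : Finset {w : InfinitePlace L // IsComplex w}) {I : Type*} [Fintype I]
    (v : I → {w : InfinitePlace L // IsComplex w}) (hcov : ∀ w, w ∉ D → ∃ i, v i = w)
    (m : ↥D → ℂ × ℂ × ℂ → ℂ) (f : ∀ d : ↥D, ↥(archLocal L 3 (Matrix.diagonal α) (d : {w : InfinitePlace L // IsComplex w})) → ℂ) (hfs : ∀ d, HasCompactSupport (f d))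
    (G : (↥D → ℂ × ℂ × ℂ) × (I → Matrix (Fin 3) (Fin 3) ℂ) → ℂ)
    {E₀ : Set ↥(arch (↥(maximalRealSubfield L)) L (IsCMField.complexConj L) 3 (Matrix.diagonal α))} (hE₀ : IsCompact E₀)
    (hG0 : ∀ k : ↥(arch (↥(maximalRealSubfield L)) L (IsCMField.complexConj L) 3 (Matrix.diagonal α)),
      (∀ d : ↥D, m d (bzClassG L α k d) ≠ 0 ∧ f d (archPiEquivCM 3 L (Matrix.diagonal α) k d) ≠ 0) →
      G (fun d : ↥D => bzClassG L α k d, fun i => ((archPiEquivCM 3 L (Matrix.diagonal α) k (v i) : GL (Fin 3) ℂ) : Matrix (Fin 3) (Fin 3) ℂ)) ≠ 0 →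
        ∃ k' ∈ E₀, ∀ i, archPiEquivCM 3 L (Matrix.diagonal α) k' (v i) = archPiEquivCM 3 L (Matrix.diagonal α) k (v i)) :
    HasCompactSupport fun k : ↥(arch (↥(maximalRealSubfield L)) L (IsCMField.complexConj L) 3 (Matrix.diagonal α)) =>
      (∏ d : ↥D, m d (bzClassG L α k d) * f d (archPiEquivCM 3 L (Matrix.diagonal α) k d)) *
        G (fun d : ↥D => bzClassG L α k d, fun i => ((archPiEquivCM 3 L (Matrix.diagonal α) k (v i) : GL (Fin 3) ℂ) : Matrix (Fin 3) (Fin 3) ℂ)) := by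
  -- the per-place compact carriers
  set C : ∀ w : {w : InfinitePlace L // IsComplex w}, Set ↥(archLocal L 3 (Matrix.diagonal α) w) := fun w =>
    if hw : w ∈ D then tsupport (f ⟨w, hw⟩)
    else (fun g : (∀ w' : {w : InfinitePlace L // IsComplex w}, ↥(archLocal L 3 (Matrix.diagonal α) w')) => g w) '' (⇑(archPiEquivCM 3 L (Matrix.diagonal α)) '' E₀) with hC
  have hCc : ∀ w, IsCompact (C w) := fun w => by
    by_cases hw : w ∈ D
    · simp only [hC, dif_pos hw]; exact (hfs ⟨w, hw⟩).isCompact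
    · simp only [hC, dif_neg hw]
      exact (hE₀.image (archPiEquivCM 3 L (Matrix.diagonal α)).continuous).image (continuous_apply w)
  have hK : IsCompact (⇑(archPiEquivCM 3 L (Matrix.diagonal α)) ⁻¹' Set.pi Set.univ C) :=
    (archPiEquivCM 3 L (Matrix.diagonal α)).toHomeomorph.isCompact_preimage.2 (isCompact_univ_pi hCc)
  refine HasCompactSupport.intro hK fun k hk => ?_
  by_contra hne
  apply hk
  have hne' := mul_ne_zero_iff.1 hne
  have hD : ∀ d : ↥D, m d (bzClassG L α k d) ≠ 0 ∧ f d (archPiEquivCM 3 L (Matrix.diagonal α) k d) ≠ 0 := fun d =>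
    mul_ne_zero_iff.1 (Finset.prod_ne_zero_iff.1 hne'.1 d (Finset.mem_univ d))
  obtain ⟨k', hk'E, hk'⟩ := hG0 k hD hne'.2
  refine Set.mem_preimage.2 (Set.mem_univ_pi.2 fun w => ?_)
  by_cases hw : w ∈ D
  · simp only [hC, dif_pos hw]
    exact subset_tsupport _ (Function.mem_support.2 (hD ⟨w, hw⟩).2)
  · simp only [hC, dif_neg hw]
    obtain ⟨i, rfl⟩ := hcov w hw
    exact ⟨archPiEquivCM 3 L (Matrix.diagonal α) k', ⟨k', hk'E, rfl⟩, hk' i⟩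

/-- **THE PER-BALL TEST FUNCTION OF THE EP ASSEMBLY IS IN `C_c^∞(G′_∞)`** (CENSUS-E3 v1 §2(7), the E3a binder «`ArchSmooth L 3 (diagonal β₀) f_J`»).  Data: a finite set `D` of places
and a block `v : I → W` covering the places off `D`; `↥D`-indexed smooth class multipliers `m_d : ℂ × ℂ × ℂ → ℂ`; one-place test functions `f_d : U(α)_d → ℂ`, each the restriction of an
ambient `C^∞` function on `M₃(ℂ)` with compact support (★ E1 ∕ ★ E3b §4 clause); a coupling factor `G : (↥D → ℂ × ℂ × ℂ) × (I → M₃(ℂ)) → ℂ` of class `C^∞` (★ (B3) p852202's currency),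
supported over a compact in the `I`-variable in the group currency `hG0` (for E3a: `E₀ = tsupport a′`).  Then
`k ↦ (Π_d m_d(bzClassG L α k d) · f_d(k_d)) · G(d ↦ bzClassG L α k d, i ↦ k_{v i})` is `ArchSmooth L 3 (diag α)` — §1 with the ambient function
`X ↦ (Π_d m_d(cl X d) · fa_d(X_d)) · G(cl_D X, X_I)` of §2 and the compact support of the previous theorem. [cite: BorelJacquet1979, §4.1] [cite: Bouaziz1994IntegralesOrbitales, §6.2 p. 591]
[cite: Rogawski1990, §14.2 p. 233] -/
theorem archSmooth_prod_classMul_tensor_mul_coupling (D : Finset {w : InfinitePlace L // IsComplex w}) {I : Type*} [Fintype I]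
    (v : I → {w : InfinitePlace L // IsComplex w}) (hcov : ∀ w, w ∉ D → ∃ i, v i = w)
    (m : ↥D → ℂ × ℂ × ℂ → ℂ) (hm : ∀ d, ContDiff ℝ ∞ (m d))
    (f : ∀ d : ↥D, ↥(archLocal L 3 (Matrix.diagonal α) (d : {w : InfinitePlace L // IsComplex w})) → ℂ)
    (hf : ∀ d, ∃ fa : Matrix (Fin 3) (Fin 3) ℂ → ℂ, ContDiff ℝ ∞ fa ∧ ∀ g, f d g = fa ((g : GL (Fin 3) ℂ) : Matrix (Fin 3) (Fin 3) ℂ)) (hfs : ∀ d, HasCompactSupport (f d))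
    (G : (↥D → ℂ × ℂ × ℂ) × (I → Matrix (Fin 3) (Fin 3) ℂ) → ℂ) (hG : ContDiff ℝ ∞ G)
    {E₀ : Set ↥(arch (↥(maximalRealSubfield L)) L (IsCMField.complexConj L) 3 (Matrix.diagonal α))} (hE₀ : IsCompact E₀)
    (hG0 : ∀ k : ↥(arch (↥(maximalRealSubfield L)) L (IsCMField.complexConj L) 3 (Matrix.diagonal α)),
      (∀ d : ↥D, m d (bzClassG L α k d) ≠ 0 ∧ f d (archPiEquivCM 3 L (Matrix.diagonal α) k d) ≠ 0) →
      G (fun d : ↥D => bzClassG L α k d, fun i => ((archPiEquivCM 3 L (Matrix.diagonal α) k (v i) : GL (Fin 3) ℂ) : Matrix (Fin 3) (Fin 3) ℂ)) ≠ 0 →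
        ∃ k' ∈ E₀, ∀ i, archPiEquivCM 3 L (Matrix.diagonal α) k' (v i) = archPiEquivCM 3 L (Matrix.diagonal α) k (v i)) :
    ArchSmooth L 3 (Matrix.diagonal α) fun k : ↥(arch (↥(maximalRealSubfield L)) L (IsCMField.complexConj L) 3 (Matrix.diagonal α)) =>
      (∏ d : ↥D, m d (bzClassG L α k d) * f d (archPiEquivCM 3 L (Matrix.diagonal α) k d)) *
        G (fun d : ↥D => bzClassG L α k d, fun i => ((archPiEquivCM 3 L (Matrix.diagonal α) k (v i) : GL (Fin 3) ℂ) : Matrix (Fin 3) (Fin 3) ℂ)) := by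
  choose fa hfa hffa using hf
  obtain ⟨cl, hcl, hclk⟩ := exists_contDiff_eq_bzClassG L α
  obtain ⟨arg, harg, hargk⟩ := exists_contDiff_couplingArg L α D v
  -- the ambient function
  have hΨ : ContDiff ℝ ∞ fun X : Matrix (Fin 3) (Fin 3) (mixedSpace L) =>
      (∏ d : ↥D, m d (cl X d) * fa d (Matrix.of fun i j => (X i j).2 (d : {w : InfinitePlace L // IsComplex w}))) * G (arg X) := by
    refine (contDiff_prod fun d _ => ?_).mul (hG.comp harg)
    exact ((hm d).comp ((contDiff_apply ℝ (ℂ × ℂ × ℂ) (d : {w : InfinitePlace L // IsComplex w})).comp hcl)).mul ((hfa d).comp (contDiff_placeMatrix L d))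
  refine archSmooth_of_eq_ambient L α hΨ (fun k => ?_)
    (hasCompactSupport_prod_classMul_tensor_mul_coupling L α D v hcov m f hfs G hE₀ hG0)
  rw [hargk k, hclk k]
  refine congrArg₂ (· * ·) (Finset.prod_congr rfl fun d _ => ?_) rfl
  rw [hffa d, placeMatrix_coe_coe L α k]

/-- **`Finset`-indexed reading** of the same theorem: families `m_w`, `f_w` indexed by ALL places (only their values on `D` are used), product `∏ w ∈ D`. [cite: BorelJacquet1979, §4.1]
[cite: Bouaziz1994IntegralesOrbitales, §6.2 p. 591] -/
theorem archSmooth_finsetProd_classMul_tensor_mul_coupling (D : Finset {w : InfinitePlace L // IsComplex w}) {I : Type*} [Fintype I]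
    (v : I → {w : InfinitePlace L // IsComplex w}) (hcov : ∀ w, w ∉ D → ∃ i, v i = w)
    (m : {w : InfinitePlace L // IsComplex w} → ℂ × ℂ × ℂ → ℂ) (hm : ∀ w ∈ D, ContDiff ℝ ∞ (m w))
    (f : ∀ w : {w : InfinitePlace L // IsComplex w}, ↥(archLocal L 3 (Matrix.diagonal α) w) → ℂ)
    (hf : ∀ w ∈ D, ∃ fa : Matrix (Fin 3) (Fin 3) ℂ → ℂ, ContDiff ℝ ∞ fa ∧ ∀ g, f w g = fa ((g : GL (Fin 3) ℂ) : Matrix (Fin 3) (Fin 3) ℂ)) (hfs : ∀ w ∈ D, HasCompactSupport (f w))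
    (G : (↥D → ℂ × ℂ × ℂ) × (I → Matrix (Fin 3) (Fin 3) ℂ) → ℂ) (hG : ContDiff ℝ ∞ G)
    {E₀ : Set ↥(arch (↥(maximalRealSubfield L)) L (IsCMField.complexConj L) 3 (Matrix.diagonal α))} (hE₀ : IsCompact E₀)
    (hG0 : ∀ k : ↥(arch (↥(maximalRealSubfield L)) L (IsCMField.complexConj L) 3 (Matrix.diagonal α)),
      (∀ w ∈ D, m w (bzClassG L α k w) ≠ 0 ∧ f w (archPiEquivCM 3 L (Matrix.diagonal α) k w) ≠ 0) →
      G (fun d : ↥D => bzClassG L α k d, fun i => ((archPiEquivCM 3 L (Matrix.diagonal α) k (v i) : GL (Fin 3) ℂ) : Matrix (Fin 3) (Fin 3) ℂ)) ≠ 0 →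
        ∃ k' ∈ E₀, ∀ i, archPiEquivCM 3 L (Matrix.diagonal α) k' (v i) = archPiEquivCM 3 L (Matrix.diagonal α) k (v i)) :
    ArchSmooth L 3 (Matrix.diagonal α) fun k : ↥(arch (↥(maximalRealSubfield L)) L (IsCMField.complexConj L) 3 (Matrix.diagonal α)) =>
      (∏ w ∈ D, m w (bzClassG L α k w) * f w (archPiEquivCM 3 L (Matrix.diagonal α) k w)) *
        G (fun d : ↥D => bzClassG L α k d, fun i => ((archPiEquivCM 3 L (Matrix.diagonal α) k (v i) : GL (Fin 3) ℂ) : Matrix (Fin 3) (Fin 3) ℂ)) := by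
  have h := archSmooth_prod_classMul_tensor_mul_coupling L α D v hcov (fun d => m d) (fun d => hm d d.2) (fun d => f d) (fun d => hf d d.2) (fun d => hfs d d.2) G hG hE₀
    (fun k hD hGk => hG0 k (fun w hw => hD ⟨w, hw⟩) hGk)
  have heq : (fun k : ↥(arch (↥(maximalRealSubfield L)) L (IsCMField.complexConj L) 3 (Matrix.diagonal α)) =>
      (∏ d : ↥D, m d (bzClassG L α k d) * f d (archPiEquivCM 3 L (Matrix.diagonal α) k d)) *
        G (fun d : ↥D => bzClassG L α k d, fun i => ((archPiEquivCM 3 L (Matrix.diagonal α) k (v i) : GL (Fin 3) ℂ) : Matrix (Fin 3) (Fin 3) ℂ))) =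
      fun k => (∏ w ∈ D, m w (bzClassG L α k w) * f w (archPiEquivCM 3 L (Matrix.diagonal α) k w)) *
        G (fun d : ↥D => bzClassG L α k d, fun i => ((archPiEquivCM 3 L (Matrix.diagonal α) k (v i) : GL (Fin 3) ℂ) : Matrix (Fin 3) (Fin 3) ℂ)) := by
    funext k
    rw [Finset.prod_coe_sort D (fun w => m w (bzClassG L α k w) * f w (archPiEquivCM 3 L (Matrix.diagonal α) k w))]
  rw [heq] at h
  exact h

end PerBall

/-! ## §5 The same with the support clause in AMBIENT currency (a compact of the ambient `I`-block `I → M₃(ℂ)`) -/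

section Ambient'

variable (L : Type) [Field L] [NumberField L] [IsCMField L] (α : Fin 3 → L)

omit [NumberField L] [IsCMField L] in
/-- `det σ_w(diag α) ≠ 0` for `α_i ≠ 0`. [cite: Rogawski1990, §4.3 p. 43] -/
theorem det_map_diagonal_ne_zero (hα : ∀ i, α i ≠ 0) (w : {w : InfinitePlace L // IsComplex w}) : ((Matrix.diagonal α).map w.1.embedding).det ≠ 0 := by
  rw [Matrix.diagonal_map (map_zero _), Matrix.det_diagonal]
  exact Finset.prod_ne_zero_iff.2 fun i _ => (map_ne_zero w.1.embedding).2 (hα i)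

omit [NumberField L] [IsCMField L] in
/-- The coercion `U(α)_w → M₃(ℂ)` is a closed embedding (★ `isClosedEmbedding_coe_unitaryGroupOfForm`, `det σ_w(diag α) ≠ 0`). [cite: Rogawski1990, §4.3 p. 43] -/
theorem isClosedEmbedding_coe_coe_archLocal_diagonal (hα : ∀ i, α i ≠ 0) (w : {w : InfinitePlace L // IsComplex w}) :
    IsClosedEmbedding fun g : ↥(archLocal L 3 (Matrix.diagonal α) w) => ((g : GL (Fin 3) ℂ) : Matrix (Fin 3) (Fin 3) ℂ) :=
  isClosedEmbedding_coe_unitaryGroupOfForm _ (det_map_diagonal_ne_zero L α hα w)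

/-- **THE PER-BALL TEST FUNCTION IS IN `C_c^∞(G′_∞)` — AMBIENT SUPPORT CLAUSE**: as `archSmooth_prod_classMul_tensor_mul_coupling`, with «`G` supported over a compact in the
`I`-variable» read on the AMBIENT block: a compact `KI ⊆ (I → M₃(ℂ))` with `G(cl_D k, k_I) = 0` whenever the `D`-factor is alive at `k` and `(k_{v i})_i ∉ KI`.  Reduction to the group
currency with `E₀ := e⁻¹(Π_w C_w)`, `C_d = tsupport f_d` on `D`, `C_w = U(α)_w ∩ ⋃_i pr_i(KI)` off `D` — compact because `U(α)_w ↪ M₃(ℂ)` is a CLOSED EMBEDDING (`α_i ≠ 0`).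
[cite: BorelJacquet1979, §4.1] [cite: Bouaziz1994IntegralesOrbitales, §6.2 p. 591] [cite: Rogawski1990, §14.2 p. 233] -/
theorem archSmooth_prod_classMul_tensor_mul_coupling_of_ambient (hα : ∀ i, α i ≠ 0) (D : Finset {w : InfinitePlace L // IsComplex w}) {I : Type*} [Fintype I]
    (v : I → {w : InfinitePlace L // IsComplex w}) (hcov : ∀ w, w ∉ D → ∃ i, v i = w)
    (m : ↥D → ℂ × ℂ × ℂ → ℂ) (hm : ∀ d, ContDiff ℝ ∞ (m d))
    (f : ∀ d : ↥D, ↥(archLocal L 3 (Matrix.diagonal α) (d : {w : InfinitePlace L // IsComplex w})) → ℂ)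
    (hf : ∀ d, ∃ fa : Matrix (Fin 3) (Fin 3) ℂ → ℂ, ContDiff ℝ ∞ fa ∧ ∀ g, f d g = fa ((g : GL (Fin 3) ℂ) : Matrix (Fin 3) (Fin 3) ℂ)) (hfs : ∀ d, HasCompactSupport (f d))
    (G : (↥D → ℂ × ℂ × ℂ) × (I → Matrix (Fin 3) (Fin 3) ℂ) → ℂ) (hG : ContDiff ℝ ∞ G)
    {KI : Set (I → Matrix (Fin 3) (Fin 3) ℂ)} (hKI : IsCompact KI)
    (hG0 : ∀ k : ↥(arch (↥(maximalRealSubfield L)) L (IsCMField.complexConj L) 3 (Matrix.diagonal α)),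
      (∀ d : ↥D, m d (bzClassG L α k d) ≠ 0 ∧ f d (archPiEquivCM 3 L (Matrix.diagonal α) k d) ≠ 0) →
      (fun i => ((archPiEquivCM 3 L (Matrix.diagonal α) k (v i) : GL (Fin 3) ℂ) : Matrix (Fin 3) (Fin 3) ℂ)) ∉ KI →
        G (fun d : ↥D => bzClassG L α k d, fun i => ((archPiEquivCM 3 L (Matrix.diagonal α) k (v i) : GL (Fin 3) ℂ) : Matrix (Fin 3) (Fin 3) ℂ)) = 0) :
    ArchSmooth L 3 (Matrix.diagonal α) fun k : ↥(arch (↥(maximalRealSubfield L)) L (IsCMField.complexConj L) 3 (Matrix.diagonal α)) =>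
      (∏ d : ↥D, m d (bzClassG L α k d) * f d (archPiEquivCM 3 L (Matrix.diagonal α) k d)) *
        G (fun d : ↥D => bzClassG L α k d, fun i => ((archPiEquivCM 3 L (Matrix.diagonal α) k (v i) : GL (Fin 3) ℂ) : Matrix (Fin 3) (Fin 3) ℂ)) := by
  -- the per-place compact carriers, the `I`-part read through the closed embedding into `M₃(ℂ)`
  set C : ∀ w : {w : InfinitePlace L // IsComplex w}, Set ↥(archLocal L 3 (Matrix.diagonal α) w) := fun w =>
    if hw : w ∈ D then tsupport (f ⟨w, hw⟩)
    else (fun g : ↥(archLocal L 3 (Matrix.diagonal α) w) => ((g : GL (Fin 3) ℂ) : Matrix (Fin 3) (Fin 3) ℂ)) ⁻¹'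
      ⋃ i : I, (fun z : I → Matrix (Fin 3) (Fin 3) ℂ => z i) '' KI with hC
  have hCc : ∀ w, IsCompact (C w) := fun w => by
    by_cases hw : w ∈ D
    · simp only [hC, dif_pos hw]; exact (hfs ⟨w, hw⟩).isCompact
    · simp only [hC, dif_neg hw]
      exact (isClosedEmbedding_coe_coe_archLocal_diagonal L α hα w).isCompact_preimage (isCompact_iUnion fun i => hKI.image (continuous_apply i))
  have hE₀ : IsCompact (⇑(archPiEquivCM 3 L (Matrix.diagonal α)) ⁻¹' Set.pi Set.univ C) :=
    (archPiEquivCM 3 L (Matrix.diagonal α)).toHomeomorph.isCompact_preimage.2 (isCompact_univ_pi hCc)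
  refine archSmooth_prod_classMul_tensor_mul_coupling L α D v hcov m hm f hf hfs G hG hE₀ fun k hD hGk => ⟨k, ?_, fun i => rfl⟩
  -- `k` itself lies in `E₀`
  have hkI : (fun i => ((archPiEquivCM 3 L (Matrix.diagonal α) k (v i) : GL (Fin 3) ℂ) : Matrix (Fin 3) (Fin 3) ℂ)) ∈ KI := by
    by_contra h
    exact hGk (hG0 k hD h)
  refine Set.mem_preimage.2 (Set.mem_univ_pi.2 fun w => ?_)
  by_cases hw : w ∈ D
  · simp only [hC, dif_pos hw]
    exact subset_tsupport _ (Function.mem_support.2 (hD ⟨w, hw⟩).2)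
  · simp only [hC, dif_neg hw]
    obtain ⟨i, rfl⟩ := hcov w hw
    exact Set.mem_preimage.2 (Set.mem_iUnion.2 ⟨i, _, hkI, rfl⟩)

/-- **THE CUT-OFF FORM** (HANDOFF-E3 §4(6): `f_J = (Π_d m_d ∘ cl_d · f_d) · (χ_I · Ã_J)(cl_D ·, ·_I)` with a cut-off `χ_I` of compact support on the ambient `I`-block): if the coupling factor
vanishes identically off a compact `KI` of the ambient `I`-block — `G (y, z) = 0` for `z ∉ KI`, every `y` — the per-ball test function is `ArchSmooth L 3 (diag α)` (`α_i ≠ 0`).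
[cite: BorelJacquet1979, §4.1] [cite: Bouaziz1994IntegralesOrbitales, §6.2 p. 591] -/
theorem archSmooth_prod_classMul_tensor_mul_coupling_of_forall_eq_zero (hα : ∀ i, α i ≠ 0) (D : Finset {w : InfinitePlace L // IsComplex w}) {I : Type*} [Fintype I]
    (v : I → {w : InfinitePlace L // IsComplex w}) (hcov : ∀ w, w ∉ D → ∃ i, v i = w)
    (m : ↥D → ℂ × ℂ × ℂ → ℂ) (hm : ∀ d, ContDiff ℝ ∞ (m d))
    (f : ∀ d : ↥D, ↥(archLocal L 3 (Matrix.diagonal α) (d : {w : InfinitePlace L // IsComplex w})) → ℂ)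
    (hf : ∀ d, ∃ fa : Matrix (Fin 3) (Fin 3) ℂ → ℂ, ContDiff ℝ ∞ fa ∧ ∀ g, f d g = fa ((g : GL (Fin 3) ℂ) : Matrix (Fin 3) (Fin 3) ℂ)) (hfs : ∀ d, HasCompactSupport (f d))
    (G : (↥D → ℂ × ℂ × ℂ) × (I → Matrix (Fin 3) (Fin 3) ℂ) → ℂ) (hG : ContDiff ℝ ∞ G)
    {KI : Set (I → Matrix (Fin 3) (Fin 3) ℂ)} (hKI : IsCompact KI) (hG0 : ∀ y, ∀ z ∉ KI, G (y, z) = 0) :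
    ArchSmooth L 3 (Matrix.diagonal α) fun k : ↥(arch (↥(maximalRealSubfield L)) L (IsCMField.complexConj L) 3 (Matrix.diagonal α)) =>
      (∏ d : ↥D, m d (bzClassG L α k d) * f d (archPiEquivCM 3 L (Matrix.diagonal α) k d)) *
        G (fun d : ↥D => bzClassG L α k d, fun i => ((archPiEquivCM 3 L (Matrix.diagonal α) k (v i) : GL (Fin 3) ℂ) : Matrix (Fin 3) (Fin 3) ℂ)) :=
  archSmooth_prod_classMul_tensor_mul_coupling_of_ambient L α hα D v hcov m hm f hf hfs G hG hKI fun _ _ hz => hG0 _ _ hz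

/-- **A SMOOTH COMPACTLY SUPPORTED COUPLING FACTOR** (`HasCompactSupport` in the `I`-variable uniformly: `G (y, ·)` vanishes off `tsupport`-type compact `KI` for all `y`) — the reading with
Mathlib's `HasCompactSupport` of `G` itself on the product space (then `KI := Prod.snd '' tsupport G`). [cite: BorelJacquet1979, §4.1] -/
theorem archSmooth_prod_classMul_tensor_mul_coupling_of_hasCompactSupport (hα : ∀ i, α i ≠ 0) (D : Finset {w : InfinitePlace L // IsComplex w}) {I : Type*} [Fintype I]
    (v : I → {w : InfinitePlace L // IsComplex w}) (hcov : ∀ w, w ∉ D → ∃ i, v i = w)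
    (m : ↥D → ℂ × ℂ × ℂ → ℂ) (hm : ∀ d, ContDiff ℝ ∞ (m d))
    (f : ∀ d : ↥D, ↥(archLocal L 3 (Matrix.diagonal α) (d : {w : InfinitePlace L // IsComplex w})) → ℂ)
    (hf : ∀ d, ∃ fa : Matrix (Fin 3) (Fin 3) ℂ → ℂ, ContDiff ℝ ∞ fa ∧ ∀ g, f d g = fa ((g : GL (Fin 3) ℂ) : Matrix (Fin 3) (Fin 3) ℂ)) (hfs : ∀ d, HasCompactSupport (f d))
    (G : (↥D → ℂ × ℂ × ℂ) × (I → Matrix (Fin 3) (Fin 3) ℂ) → ℂ) (hG : ContDiff ℝ ∞ G) (hGs : HasCompactSupport G) :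
    ArchSmooth L 3 (Matrix.diagonal α) fun k : ↥(arch (↥(maximalRealSubfield L)) L (IsCMField.complexConj L) 3 (Matrix.diagonal α)) =>
      (∏ d : ↥D, m d (bzClassG L α k d) * f d (archPiEquivCM 3 L (Matrix.diagonal α) k d)) *
        G (fun d : ↥D => bzClassG L α k d, fun i => ((archPiEquivCM 3 L (Matrix.diagonal α) k (v i) : GL (Fin 3) ℂ) : Matrix (Fin 3) (Fin 3) ℂ)) :=
  archSmooth_prod_classMul_tensor_mul_coupling_of_forall_eq_zero L α hα D v hcov m hm f hf hfs G hG (hGs.isCompact.image continuous_snd) fun y z hz =>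
    image_eq_zero_of_notMem_tsupport fun h => hz ⟨(y, z), h, rfl⟩

end Ambient'

end Literature.NumberTheory.Rogawski1990
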